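import Literature.Barriers.CriticalPhenomena.GaussianDominationRouteProp74Events
import Literature.Barriers.CriticalPhenomena.GaussianDominationRouteLaceExpansionMeasurable
import HarnessLib

/-!
# Towards `HvdH2017_prop74_holds` (Heydenreich–van der Hofstad, Prop. 7.4), I′: the BK/Tonelli
# reduction of `Π^{(N)}`, `N ≥ 1`, through the coupled expectations to a nested diagram

Sibling proof file of `GaussianDominationRouteDiagrams.lean` (which vendors Prop. 7.4 as the named
fact `HvdH2017_prop74`). It builds on `GaussianDominationRouteProp74Events.lean` (the inclusion
(7.3.9) and its six-connection BK bound `measure_laceE_inter_restrCluster_le`) and on the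
Tonelli pattern of `GaussianDominationRouteDiagramsProofs.lean` (`kerE_le_diagram`,
`measure_doubleConn_inter_le`), and performs the induction through the nesting operator
(6.2.24)–(6.2.28) (`nestOp`, `nestIter` of `GaussianDominationRouteLaceExpansion.lean`):

* `wF'`, `wF''`, `phiK` — the BK weights of `F'`, `F''` ((7.3.3)–(7.3.4), (7.4.7)–(7.4.8)) and
  their sum over `t, w`, so that `measure_laceE_inter_le` reads
  `P_p(E'(v,u;A) ∩ {z' ∈ C̃^{(u,v')}(v)}) ≤ Σ_z 𝟙_A(z) φ(v,z,u,z')`;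
* `gK n` — the recursive kernel bound: `g₀(v,z,x) = Σ_t τ(t-v)τ(z-t)τ(x-t)τ(x-z)` ((7.2.22)/(7.4.6))
  and `g_{n+1}(v,z,x) = Σ_{(u,v')} J(u,v') Σ_{z'} φ(v,z,u,z') g_n(v',z',x)`;
* `lintegral_indicator_kernel_le` (Tonelli step), `nestIter_kerE_le` —
  **`(𝒩ⁿ kerE)(A,v,x) ≤ Σ_z 𝟙_A(z) g_n(v,z,x)`** for every `n`, `A`, `v`, `x`;
* `lacePiT_succ_le` — **`Π̃^{(n+1)}(x) ≤ Σ_{(u,v)} J(u,v) Σ_{z'} [Σ_w τ(u)τ(w)τ(u-w)τ(z'-w)] g_n(v,z',x)`**,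
  which is (7.3.11) with (7.4.5)–(7.4.9) substituted, organised from the right end `x` (the `J`-sums,
  producing `B₁, B₂, A₃` of (7.4.2)–(7.4.4) and the chain (7.4.10), are performed in the sibling
  `…DiagramsProp74.lean`).

Everything here holds for every `p` (all quantities in `ℝ≥0∞`). No named fact is introduced.

## References

* M. Heydenreich, R. van der Hofstad, *Progress in High-Dimensional Percolation and Random
  Graphs* (Springer 2017): (6.2.24)–(6.2.28), §7.3 ((7.3.1)–(7.3.11)), §7.4 ((7.4.5)–(7.4.10)).
-/

noncomputable section

namespace Literature.Barriers.CriticalPhenomena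



/-! ### BK and Tonelli: from (7.3.9) to the nested diagram bound on `Π^{(N)}` -/

section Nested

open MeasureTheory Literature.Probability.LatticeModels Literature.Probability.Percolation
open scoped ENNReal

variable {d : ℕ}

/-- The weight of `F'(v,t,z,u,w,z')`: `τ(t-v) τ(z-t) τ(w-t) τ(u-z) τ(u-w) τ(z'-w)`.
[cite: HeydenreichVanDerHofstad2017, (7.3.3) and (7.4.7)] -/
def wF' (d : ℕ) (p : unitInterval) (v z u z' t w : Site d) : ℝ≥0∞ :=
  tauE d p (t - v) * tauE d p (z - t) * tauE d p (w - t) * tauE d p (u - z) *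
    tauE d p (u - w) * tauE d p (z' - w)

/-- The weight of `F''(v,t,z,u,w,z')`: `τ(w-v) τ(t-w) τ(z-t) τ(u-t) τ(u-z) τ(z'-w)`.
[cite: HeydenreichVanDerHofstad2017, (7.3.4) and (7.4.8)] -/
def wF'' (d : ℕ) (p : unitInterval) (v z u z' t w : Site d) : ℝ≥0∞ :=
  tauE d p (w - v) * tauE d p (t - w) * tauE d p (z - t) * tauE d p (u - t) *
    tauE d p (u - z) * tauE d p (z' - w)

/-- **`φ(v, z, u, z') = Σ_{t,w} [weight of F' + weight of F'']`**, the BK bound on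
`P_p(E'(v,u;A) ∩ {z' ∈ C̃}, z the vertex of A on the last sausage)`.
[cite: HeydenreichVanDerHofstad2017, (7.3.9) with (7.4.7)–(7.4.9)] -/
def phiK (d : ℕ) (p : unitInterval) (v z u z' : Site d) : ℝ≥0∞ :=
  ∑' t, ∑' w, (wF' d p v z u z' t w + wF'' d p v z u z' t w)

/-- Unfolding lemma. [folklore] -/
theorem wF'_def (p : unitInterval) (v z u z' t w : Site d) : wF' d p v z u z' t w =
    tauE d p (t - v) * tauE d p (z - t) * tauE d p (w - t) * tauE d p (u - z) *
      tauE d p (u - w) * tauE d p (z' - w) := rfl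

/-- Unfolding lemma. [folklore] -/
theorem wF''_def (p : unitInterval) (v z u z' t w : Site d) : wF'' d p v z u z' t w =
    tauE d p (w - v) * tauE d p (t - w) * tauE d p (z - t) * tauE d p (u - t) *
      tauE d p (u - z) * tauE d p (z' - w) := rfl

/-- Unfolding lemma. [folklore] -/
theorem phiK_def (p : unitInterval) (v z u z' : Site d) :
    phiK d p v z u z' = ∑' t, ∑' w, (wF' d p v z u z' t w + wF'' d p v z u z' t w) := rfl

/-- **(7.3.9) + BK** (the tree's `measure_laceE_inter_restrCluster_le`, folded into `φ`):
`P_p(E'(v,u;A) ∩ {z' ∈ C̃^{(u,v')}(v)}) ≤ Σ_z 𝟙{z ∈ A} φ(v, z, u, z')`.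
[cite: HeydenreichVanDerHofstad2017, (7.3.9), (7.4.7)–(7.4.9)] -/
theorem measure_laceE_inter_le (p : unitInterval) (A : Set (Site d)) (v u v' z' : Site d) :
    bondPercolation (zdGraph d) p (laceE A v u ∩ {ω | z' ∈ restrCluster u v' v ω}) ≤
      ∑' z, A.indicator (fun _ => (1 : ℝ≥0∞)) z * phiK d p v z u z' :=
  measure_laceE_inter_restrCluster_le p A v u v' z'

/-- **The recursive diagram bound `g_n(v, z, x)`** on the nested expectations:
`g₀(v,z,x) = Σ_t τ(t-v) τ(z-t) τ(x-t) τ(x-z)` ((7.2.22)/(7.4.6)) and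
`g_{n+1}(v,z,x) = Σ_{(u,v')} J(u,v') Σ_{z'} φ(v,z,u,z') g_n(v',z',x)` ((7.3.11) read from the right).
[cite: HeydenreichVanDerHofstad2017, (7.3.11), (7.4.5)–(7.4.10)] -/
def gK (d : ℕ) (p : unitInterval) : ℕ → Site d → Site d → Site d → ℝ≥0∞
  | 0, v, z, x => ∑' t, tauE d p (t - v) * tauE d p (z - t) * tauE d p (x - t) * tauE d p (x - z)
  | n + 1, v, z, x => ∑' b : Site d × Site d, ENNReal.ofReal (bondJ d p (b.2 - b.1)) *
      ∑' z', phiK d p v z b.1 z' * gK d p n b.2 z' x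

/-- Unfolding lemma. [folklore] -/
theorem gK_zero (p : unitInterval) (v z x : Site d) : gK d p 0 v z x =
    ∑' t, tauE d p (t - v) * tauE d p (z - t) * tauE d p (x - t) * tauE d p (x - z) := rfl

/-- Unfolding lemma. [folklore] -/
theorem gK_succ (p : unitInterval) (n : ℕ) (v z x : Site d) : gK d p (n + 1) v z x =
    ∑' b : Site d × Site d, ENNReal.ofReal (bondJ d p (b.2 - b.1)) *
      ∑' z', phiK d p v z b.1 z' * gK d p n b.2 z' x := rfl

/-- **Tonelli step**: if a kernel obeys `h(C, v'', x) ≤ Σ_{z'} 𝟙{z' ∈ C} G(z')` then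
`∫ 𝟙_E(ω) h(C̃^{(u,v')}(w₀)(ω), v'', x) dP_p ≤ Σ_{z'} P_p(E ∩ {z' ∈ C̃^{(u,v')}(w₀)}) G(z')`.
[cite: HeydenreichVanDerHofstad2017, (7.2.23)–(7.2.25) and (7.3.10)–(7.3.11)] -/
theorem lintegral_indicator_kernel_le (p : unitInterval) {h : LaceKernel d} {G : Site d → ℝ≥0∞}
    {E : Set (BondConfig (Site d))} (hE : MeasurableSet E) (u v' w₀ v'' x : Site d)
    (hh : ∀ C, h C v'' x ≤ ∑' z', C.indicator (fun _ => (1 : ℝ≥0∞)) z' * G z') :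
    ∫⁻ ω, E.indicator (fun ω => h (restrCluster u v' w₀ ω) v'' x) ω ∂(bondPercolation (zdGraph d) p) ≤
      ∑' z', bondPercolation (zdGraph d) p (E ∩ {ω | z' ∈ restrCluster u v' w₀ ω}) * G z' := by
  set μ := bondPercolation (zdGraph d) p with hμ
  set Ez : Site d → Set (BondConfig (Site d)) := fun z => E ∩ {ω | z ∈ restrCluster u v' w₀ ω} with hEz
  have hmeas : ∀ z, MeasurableSet (Ez z) := fun z =>
    hE.inter (measurable_set_iff.1 (measurable_restrCluster u v' w₀) z).setOf
  have hpt : ∀ ω, E.indicator (fun ω => h (restrCluster u v' w₀ ω) v'' x) ω ≤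
      ∑' z, (Ez z).indicator (fun _ => (1 : ℝ≥0∞)) ω * G z := by
    intro ω
    by_cases hω : ω ∈ E
    · rw [Set.indicator_of_mem hω]
      refine (hh _).trans (ENNReal.tsum_le_tsum fun z => mul_le_mul' ?_ le_rfl)
      by_cases hz : z ∈ restrCluster u v' w₀ ω
      · rw [Set.indicator_of_mem hz, Set.indicator_of_mem (show ω ∈ Ez z from ⟨hω, hz⟩)]
      · rw [Set.indicator_of_notMem hz]
        exact zero_le
    · rw [Set.indicator_of_notMem hω]
      exact zero_le
  calc ∫⁻ ω, E.indicator (fun ω => h (restrCluster u v' w₀ ω) v'' x) ω ∂μ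
      ≤ ∫⁻ ω, ∑' z, (Ez z).indicator (fun _ => (1 : ℝ≥0∞)) ω * G z ∂μ := lintegral_mono hpt
    _ = ∑' z, ∫⁻ ω, (Ez z).indicator (fun _ => (1 : ℝ≥0∞)) ω * G z ∂μ :=
        lintegral_tsum fun z => ((measurable_const.indicator (hmeas z)).mul_const _).aemeasurable
    _ = ∑' z, μ (Ez z) * G z := by
        refine tsum_congr fun z => ?_
        rw [lintegral_mul_const _ (measurable_const.indicator (hmeas z))]
        have h1 : ∫⁻ ω, (Ez z).indicator (fun _ => (1 : ℝ≥0∞)) ω ∂μ = μ (Ez z) :=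
          lintegral_indicator_one (hmeas z)
        rw [h1]

/-- **The nested induction** ((7.3.8)–(7.3.11) with (7.4.6)–(7.4.9)):
`(𝒩ⁿ kerE)(A, v, x) ≤ Σ_z 𝟙{z ∈ A} g_n(v, z, x)` for every `n`, every set `A` and all `v, x`.
[cite: HeydenreichVanDerHofstad2017, (7.3.8)–(7.3.11), (7.4.6)–(7.4.10)] -/
theorem nestIter_kerE_le (p : unitInterval) :
    ∀ (n : ℕ) (A : Set (Site d)) (v x : Site d),
      nestIter d p (kerE d p) n A v x ≤ ∑' z, A.indicator (fun _ => (1 : ℝ≥0∞)) z * gK d p n v z x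
  | 0, A, v, x => by
    rw [nestIter_zero]
    refine (kerE_le_diagram p A v x).trans (le_of_eq (tsum_congr fun z => ?_))
    rw [gK_zero, ← ENNReal.tsum_mul_left]
  | n + 1, A, v, x => by
    set μ := bondPercolation (zdGraph d) p with hμ
    rw [nestIter_succ, nestOp_apply]
    -- bound each `b`-term
    have hb : ∀ b : Site d × Site d,
        ∫⁻ ω, (laceE A v b.1).indicator
            (fun ω => nestIter d p (kerE d p) n (restrCluster b.1 b.2 v ω) b.2 x) ω ∂μ ≤
          ∑' z', (∑' z, A.indicator (fun _ => (1 : ℝ≥0∞)) z * phiK d p v z b.1 z') *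
            gK d p n b.2 z' x := fun b =>
      (lintegral_indicator_kernel_le p (measurableSet_laceE A v b.1) b.1 b.2 v b.2 x
        (fun C => nestIter_kerE_le p n C b.2 x)).trans
        (ENNReal.tsum_le_tsum fun z' => mul_le_mul' (measure_laceE_inter_le p A v b.1 b.2 z') le_rfl)
    calc ∑' b : Site d × Site d, ENNReal.ofReal (bondJ d p (b.2 - b.1)) *
          ∫⁻ ω, (laceE A v b.1).indicator
            (fun ω => nestIter d p (kerE d p) n (restrCluster b.1 b.2 v ω) b.2 x) ω ∂μ
        ≤ ∑' b : Site d × Site d, ENNReal.ofReal (bondJ d p (b.2 - b.1)) *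
          ∑' z', (∑' z, A.indicator (fun _ => (1 : ℝ≥0∞)) z * phiK d p v z b.1 z') *
            gK d p n b.2 z' x := ENNReal.tsum_le_tsum fun b => mul_le_mul' le_rfl (hb b)
      _ = ∑' b : Site d × Site d, ∑' z', ∑' z, A.indicator (fun _ => (1 : ℝ≥0∞)) z *
          (ENNReal.ofReal (bondJ d p (b.2 - b.1)) * (phiK d p v z b.1 z' * gK d p n b.2 z' x)) := by
          refine tsum_congr fun b => ?_
          rw [← ENNReal.tsum_mul_left]
          refine tsum_congr fun z' => ?_
          rw [← ENNReal.tsum_mul_right, ← ENNReal.tsum_mul_left]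
          exact tsum_congr fun z => by ring
      _ = ∑' b : Site d × Site d, ∑' z, ∑' z', A.indicator (fun _ => (1 : ℝ≥0∞)) z *
          (ENNReal.ofReal (bondJ d p (b.2 - b.1)) * (phiK d p v z b.1 z' * gK d p n b.2 z' x)) :=
          tsum_congr fun b => ENNReal.tsum_comm
      _ = ∑' z, ∑' b : Site d × Site d, ∑' z', A.indicator (fun _ => (1 : ℝ≥0∞)) z *
          (ENNReal.ofReal (bondJ d p (b.2 - b.1)) * (phiK d p v z b.1 z' * gK d p n b.2 z' x)) :=
          ENNReal.tsum_comm
      _ = _ := by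
          refine tsum_congr fun z => ?_
          rw [gK_succ, ← ENNReal.tsum_mul_left]
          refine tsum_congr fun b => ?_
          rw [← ENNReal.tsum_mul_left, ← ENNReal.tsum_mul_left]

/-- **The nested diagram bound on `Π^{(N)}`, `N ≥ 1`** ((7.3.11) with (7.4.5)–(7.4.9), in `ℝ≥0∞`,
for every `p`): `Π̃^{(n+1)}(x) ≤ Σ_{(u,v)} J(u,v) Σ_{z'} [Σ_w τ(u) τ(w) τ(u-w) τ(z'-w)] g_n(v, z', x)`.
[cite: HeydenreichVanDerHofstad2017, (7.3.11), (7.4.5)–(7.4.10)] -/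
theorem lacePiT_succ_le (p : unitInterval) (n : ℕ) (x : Site d) :
    lacePiT d p (n + 1) x ≤ ∑' b : Site d × Site d, ENNReal.ofReal (bondJ d p (b.2 - b.1)) *
      ∑' z', (∑' w, tauE d p b.1 * tauE d p w * tauE d p (b.1 - w) * tauE d p (z' - w)) *
        gK d p n b.2 z' x := by
  rw [lacePiT_succ, nestOp_apply]
  refine ENNReal.tsum_le_tsum fun b => mul_le_mul' le_rfl ?_
  refine (lintegral_indicator_kernel_le p (measurableSet_laceE Set.univ 0 b.1) b.1 b.2 0 b.2 x
    (fun C => nestIter_kerE_le p n C b.2 x)).trans ?_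
  exact ENNReal.tsum_le_tsum fun z' => mul_le_mul' (measure_doubleConn_inter_le p b.1 b.2 z') le_rfl

end Nested

end Literature.Barriers.CriticalPhenomena

end
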